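import Mathlib.CategoryTheory.Pi.Basic
import Mathlib.CategoryTheory.Limits.Shapes.Products
import Mathlib.CategoryTheory.Limits.Shapes.IsTerminal
import Mathlib.CategoryTheory.Limits.Shapes.BinaryProducts
import Literature.AnabelianGeometry.SemiGraphs.QuasiTemperoids

/-!
# Semi-graphs of anabelioids, Appendix: products of categories — cocones detected coordinatewise, cofans with initial summands

Mochizuki, *Semi-graphs of anabelioids*, Publ. RIMS **42** (2006), Appendix, Proposition A.2 (v) p. 80
("`φ` coincides with the morphism of quasi-temperoids formed by 'taking the product' [in the evident
sense] of the `φ_e`"). PROOF-ONLY support file (theorems, no definitions) by abc-iut-w4-d076 for the proof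
of `PropA2v` (abc-iut-L3-t2's `QuasiTemperoids.lean`): the elementary category theory of the product
category `∏_e Q_e` (Mathlib `CategoryTheory.pi`) and of cofans that the print's "evident sense" uses —

* (co)limit (co)cones of `∏_e Q_e` are detected coordinatewise (`Pi.nonempty_isColimit_of_eval`,
  `Pi.nonempty_isLimit_of_eval`; Mathlib's `CategoryTheory.Limits.Pi` assembles cones but fixes all
  universes equal, which `PropA2v` does not);
* a cofan all of whose summands but one are initial: it is a coproduct iff the distinguished leg is an
  isomorphism (`nonempty_isColimit_cofan_of_isIso`, `isIso_inj_of_isColimit_cofan`); a coproduct of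
  initial objects is initial (`nonempty_isInitial_pt_of_isColimit_cofan`).

[cite: MochizukiSemiAnbd2006, Prop A.2(v) p.80]; folklore category theory, recorded for the kernel.
-/

open CategoryTheory CategoryTheory.Limits

namespace Literature.AnabelianGeometry.SemiGraphs

universe w w' v v' u u'

/-! ### (Co)limits in `∏_i C_i` are detected coordinatewise -/

section PiCocones

variable {I : Type w} {C : I → Type u} [∀ i, Category.{v} (C i)]
variable {J : Type u'} [Category.{v'} J] {D : J ⥤ ∀ i, C i}

/-- A cocone of `∏_i C_i` all of whose coordinate cocones are colimits is a colimit (the descent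
morphism is assembled coordinatewise). [cite: MochizukiSemiAnbd2006, Prop A.2(v) p.80] -/
theorem Pi.nonempty_isColimit_of_eval (c : Cocone D)
    (h : ∀ i, Nonempty (IsColimit ((Pi.eval C i).mapCocone c))) : Nonempty (IsColimit c) :=
  ⟨{ desc := fun s i => (h i).some.desc ((Pi.eval C i).mapCocone s)
     fac := fun s j => funext fun i => (h i).some.fac ((Pi.eval C i).mapCocone s) j
     uniq := fun s m hm => funext fun i =>
       (h i).some.uniq ((Pi.eval C i).mapCocone s) (m i) fun j => congrFun (hm j) i }⟩

/-- A cone of `∏_i C_i` all of whose coordinate cones are limits is a limit.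
[cite: MochizukiSemiAnbd2006, Prop A.2(v) p.80] -/
theorem Pi.nonempty_isLimit_of_eval (c : Cone D)
    (h : ∀ i, Nonempty (IsLimit ((Pi.eval C i).mapCone c))) : Nonempty (IsLimit c) :=
  ⟨{ lift := fun s i => (h i).some.lift ((Pi.eval C i).mapCone s)
     fac := fun s j => funext fun i => (h i).some.fac ((Pi.eval C i).mapCone s) j
     uniq := fun s m hm => funext fun i =>
       (h i).some.uniq ((Pi.eval C i).mapCone s) (m i) fun j => congrFun (hm j) i }⟩

end PiCocones

/-! ### Cofans with initial summands -/

section Cofans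

variable {C : Type u} [Category.{v} C] {K : Type w} {X : K → C}

/-- A cofan whose summands other than `X i₀` are initial and whose `i₀`-th leg is an isomorphism is a
coproduct. [cite: MochizukiSemiAnbd2006, Prop A.2(v) p.80] -/
theorem nonempty_isColimit_cofan_of_isIso (c : Cofan X) (i₀ : K) (hi : IsIso (c.inj i₀))
    (h : ∀ i, i ≠ i₀ → Nonempty (IsInitial (X i))) : Nonempty (IsColimit c) := by
  classical
  haveI := hi
  refine ⟨Cofan.IsColimit.mk c (fun s => inv (c.inj i₀) ≫ s.inj i₀) (fun s i => ?_) (fun s m hm => ?_)⟩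
  · by_cases hi : i = i₀
    · subst hi
      rw [IsIso.hom_inv_id_assoc]
    · exact (h i hi).some.hom_ext _ _
  · rw [← hm i₀, IsIso.inv_hom_id_assoc]

/-- In a coproduct whose summands other than `X i₀` are initial, the `i₀`-th leg is an isomorphism.
[cite: MochizukiSemiAnbd2006, Prop A.2(v) p.80] -/
theorem isIso_inj_of_isColimit_cofan {c : Cofan X} (hc : IsColimit c) (i₀ : K)
    (h : ∀ i, i ≠ i₀ → Nonempty (IsInitial (X i))) : IsIso (c.inj i₀) := by
  classical
  -- the inverse: descend the cofan `X i₀ ← X i₀` (identity), `X i₀ ← X i` (from initial)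
  let g : ∀ i, X i ⟶ X i₀ := fun i =>
    if hi : i = i₀ then eqToHom (congrArg X hi) else (h i hi).some.to (X i₀)
  have hg : g i₀ = 𝟙 (X i₀) := by simp [g]
  refine ⟨Cofan.IsColimit.desc hc g, ?_, ?_⟩
  · rw [Cofan.IsColimit.fac, hg]
  · refine Cofan.IsColimit.hom_ext hc _ _ fun i => ?_
    by_cases hi : i = i₀
    · subst hi
      rw [← Category.assoc, Cofan.IsColimit.fac, hg, Category.id_comp, Category.comp_id]
    · exact (h i hi).some.hom_ext _ _

/-- A coproduct of initial objects is initial. [cite: MochizukiSemiAnbd2006, Prop A.2(v) p.80] -/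
theorem nonempty_isInitial_pt_of_isColimit_cofan {c : Cofan X} (hc : IsColimit c)
    (h : ∀ i, Nonempty (IsInitial (X i))) : Nonempty (IsInitial c.pt) :=
  ⟨IsInitial.ofUniqueHom (fun Z => Cofan.IsColimit.desc hc fun i => (h i).some.to Z)
    fun _ _ => Cofan.IsColimit.hom_ext hc _ _ fun i => (h i).some.hom_ext _ _⟩

/-- A coproduct that is NOT initial has a summand that is not initial.
[cite: MochizukiSemiAnbd2006, Prop A.2(v) p.80] -/
theorem exists_not_isInitial_of_isColimit_cofan {c : Cofan X} (hc : IsColimit c)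
    (hpt : IsEmpty (IsInitial c.pt)) : ∃ i, IsEmpty (IsInitial (X i)) := by
  by_contra hall
  push Not at hall
  exact hpt.false (nonempty_isInitial_pt_of_isColimit_cofan hc hall).some

end Cofans

/-! ### (Co)cones over diagrams of initial objects -/

section InitialDiagrams

variable {C : Type u} [Category.{v} C] {J : Type u'} [Category.{v'} J] {D : J ⥤ C}

/-- A cocone over a diagram of initial objects whose apex is initial is a colimit.
[cite: MochizukiSemiAnbd2006, Prop A.2(v) p.80] -/
theorem nonempty_isColimit_of_isInitial (c : Cocone D) (hD : ∀ j, Nonempty (IsInitial (D.obj j)))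
    (hc : Nonempty (IsInitial c.pt)) : Nonempty (IsColimit c) :=
  ⟨{ desc := fun s => hc.some.to s.pt
     fac := fun _ j => (hD j).some.hom_ext _ _
     uniq := fun _ _ _ => hc.some.hom_ext _ _ }⟩

/-- A cone over a NONEMPTY diagram of initial objects is a limit, provided initial objects are strict
(an object mapping to an initial object is initial — as in quasi-temperoids): every cone's apex maps
to an initial object, so is initial.
[cite: MochizukiSemiAnbd2006, Prop A.2(v) p.80] -/
theorem nonempty_isLimit_of_isInitial (c : Cone D) (j₀ : J)
    (hstrict : ∀ {A B : C} (_ : A ⟶ B), Nonempty (IsInitial B) → Nonempty (IsInitial A))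
    (hD : ∀ j, Nonempty (IsInitial (D.obj j))) : Nonempty (IsLimit c) :=
  ⟨{ lift := fun s => (hstrict (s.π.app j₀) (hD j₀)).some.to c.pt
     fac := fun s _ => (hstrict (s.π.app j₀) (hD j₀)).some.hom_ext _ _
     uniq := fun s _ _ => (hstrict (s.π.app j₀) (hD j₀)).some.hom_ext _ _ }⟩

/-- A cone over an EMPTY diagram whose apex is terminal is a limit.
[cite: MochizukiSemiAnbd2006, Prop A.2(v) p.80] -/
theorem nonempty_isLimit_of_isEmpty_of_isTerminal [IsEmpty J] (c : Cone D)
    (hc : Nonempty (IsTerminal c.pt)) : Nonempty (IsLimit c) :=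
  ⟨{ lift := fun s => hc.some.from s.pt
     fac := fun _ j => isEmptyElim j
     uniq := fun _ _ _ => hc.some.hom_ext _ _ }⟩

/-- The apex of a limit cone over an EMPTY diagram is terminal.
[cite: MochizukiSemiAnbd2006, Prop A.2(v) p.80] -/
theorem nonempty_isTerminal_of_isLimit_of_isEmpty [IsEmpty J] {c : Cone D} (hc : IsLimit c) :
    Nonempty (IsTerminal c.pt) :=
  ⟨IsTerminal.ofUniqueHom (fun Z => hc.lift ⟨Z, ⟨fun j => isEmptyElim j, fun j => isEmptyElim j⟩⟩)
    fun Z m => hc.uniq ⟨Z, ⟨fun j => isEmptyElim j, fun j => isEmptyElim j⟩⟩ m fun j => isEmptyElim j⟩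

/-- For a terminal object `T`, the fan `T ⟵𝟙 T ⟶𝟙 T` is a binary product.
[cite: MochizukiSemiAnbd2006, Prop A.2(v) p.80] -/
theorem nonempty_isLimit_binaryFan_id_of_isTerminal {T : C} (hT : IsTerminal T) :
    Nonempty (IsLimit (BinaryFan.mk (𝟙 T) (𝟙 T))) :=
  ⟨BinaryFan.isLimitMk (fun s => hT.from s.pt) (fun _ => hT.hom_ext _ _) (fun _ => hT.hom_ext _ _)
    fun _ _ _ _ => hT.hom_ext _ _⟩

/-- If `K ⟵𝟙 K ⟶𝟙 K` is a binary product then `K` is subterminal: any two parallel arrows into `K`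
agree. [cite: MochizukiSemiAnbd2006, Prop A.2(v) p.80] -/
theorem eq_of_isLimit_binaryFan_id {K : C} (hK : IsLimit (BinaryFan.mk (𝟙 K) (𝟙 K))) {Z : C}
    (f g : Z ⟶ K) : f = g := by
  have h1 : hK.lift (BinaryFan.mk f g) ≫ 𝟙 K = f := hK.fac (BinaryFan.mk f g) ⟨WalkingPair.left⟩
  have h2 : hK.lift (BinaryFan.mk f g) ≫ 𝟙 K = g := hK.fac (BinaryFan.mk f g) ⟨WalkingPair.right⟩
  exact h1.symm.trans h2

end InitialDiagrams

end Literature.AnabelianGeometry.SemiGraphs
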